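import Summits.BirchSwinnertonDyer.BirchSwinnertonDyer.Theorems.ErratumRoadFiveBigRepInvariantsShift
import HarnessLib

/-!
# The invariants `𝓜^G` of the ITERATED big representation `𝓜 = bigRep κ₁ (bigRep κ₂ ρ)` as SECTIONS over
# the coset space `ℤ_p²/c(G)`, `c = (κ₁, κ₂)`: two-variable invariance, determination by the values on a
# covering set, uniform smoothness of `c`-small elements on `A^{ker c}` (compactness), finite coset
# representatives, and the value action of `(1+T_c)^N − 1` (helper, `--supports stmt-BirchSwinnertonDyer-25505`)

Cell `bsd-stepL`, seat `bsd-stepL-imc-p1` (prover g23, 2026-08-28). Theorems only (no definition, no named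
fact, no `sorry`, no instance, no notation). First half of the KERNEL ASSEMBLY of the v4 stub
`stub_localDefectFiniteAnomalous` (S2♭♭) of line `erratum_chain` of crux 25505 `ErratumThm23SigmaLe` — the
finiteness of the LOCAL control defect `𝓜^{Γ_{K_𝔭̄}}/T_c 𝓜^{Γ_{K_𝔭̄}}` of [JSW17, Lemma 3.4.1] for the
two-variable big representation. Route (this seat's, replacing the two-level bookkeeping of memo
`CORNER-25505-imc-p1-g22.md` §7 by a direct two-variable reading): an element of the iterate
`BigRepModule Λ p (BigRepModule 𝒪 p A)` is a smooth `p`-primary function `Φ : ℤ_p × ℤ_p → A` (outer variable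
`x` ↔ `κ₁`, `T_c`; inner variable `y` ↔ `κ₂`), `G` acts by `(g·Φ)(x, y) = ρ(g) Φ(x − κ₁ g, y − κ₂ g)`, so
`𝓜^G` is the module of SECTIONS `Φ(z + c g) = ρ(g) Φ(z)`, `c = (κ₁, κ₂) : G → ℤ_p²`: determined by its values
(in `A^{ker c}`) on any set of representatives of `ℤ_p²/c(G)`, and on it `(1+T_c)^N − 1` is the value
endomorphism `ρ(g₁) − 1` for `g₁ ∈ ker κ₂` with `κ₁ g₁ = N` (file `…BigRepInvariantsShift`, twice).

## What is proved (any topological group `G`, any coefficient ring `𝒪`, any discrete `𝒪`-module `A`)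

* §1 `bigRep_bigRep_apply_apply` (the two-variable action), `apply_add_apply_add_of_forall_eq` (invariance
  read at a shifted point: `Φ(x + κ₁ g)(y + κ₂ g) = ρ g (Φ x y)`), `apply_apply_eq_of_forall_eq` (the values of
  an invariant are fixed by `ker c`), `eq_of_forall_eq_of_cover` (two invariants agreeing on a set `R` meeting
  every coset of `c(G)` are equal).
* §2 `exists_level_of_forall_fixed` — **uniform smoothness from COMPACTNESS**: for `G` compact and a finite
  set `S ⊆ A^{ker c}` there is `m` with `ρ(g) b = b` for all `b ∈ S` whenever `c(g) ∈ p^m ℤ_p²` (the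
  complement of the open stabiliser is compact, so its image under the continuous `c` is closed and misses `0`).
* §3 `exists_finset_cover_indep` — if `c(G) ⊇ pⁿℤ_p²` ((OPEN): the decomposition group is open in
  `Γ_K ≅ ℤ_p²`) there is a FINITE set `R ⊆ ℤ_p²` meeting every coset of `c(G)` exactly once
  (representatives `Quotient.out` of the finite group `ℤ_p²/c(G)`).
* §4 `one_add_X_pow_sub_one_smul_apply_apply` — for invariant `Φ`, `g₁ ∈ ker κ₂`, `κ₁ g₁ = N`:
  `((((1+T_c)^N − 1)) • Φ) x y = ρ g₁ (Φ x y) − Φ x y`.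

HONEST FRAMING: module/topological-group bookkeeping on the tree's constructed carriers; nothing about any
newform or curve; conditional on nothing; BSD is proved for no pair; closes: none (T7).

## References
* [JetchevSkinnerWan2017] §3.4, Lemma 3.4.1 and its proof (arXiv:1512.06894 p. 14: the local term
  `𝓜^{G_{K_v}}/(γ₊ − 1)𝓜^{G_{K_v}}`), Case 3(b) p. 13 (`P_v`, `𝓜^{P_v}`).
* [SkinnerUrban2014] §3.1.3, Prop. 3.2.3 (the co-induced model `Λ^* = lim Maps(Γ/Γ^{pⁿ}, ·)`).
* [Castella2018] §2.1–2.2 (`𝒜 = T ⊗ Λ^*`, action `ρ ⊗ Ψ⁻¹`, `1 + T ↦ γ`).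
-/

noncomputable section

open PowerSeries Literature.NumberTheory.GaloisRepresentations Literature.NumberTheory.EllipticCurves
  Literature.NumberTheory.EllipticCurves.BigRepModule
open scoped Pointwise

-- D-0017: single-problem summit, the namespace repeats the problem name by design.
set_option linter.dupNamespace false
set_option autoImplicit false

namespace Summit.BirchSwinnertonDyer.BirchSwinnertonDyer.Theorems.ErratumThm23TwoVariable.Sections

variable {𝒪 : Type*} [CommRing 𝒪] [TopologicalSpace 𝒪] {p : ℕ} [Fact p.Prime]
  {A : Type*} [AddCommGroup A] [Module 𝒪 A] [TopologicalSpace A] [DiscreteTopology A]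
  {G : Type*} [Group G] [TopologicalSpace G] [IsTopologicalGroup G]
  [TopologicalSpace (PowerSeries 𝒪)] [TopologicalSpace (PowerSeries (PowerSeries 𝒪))]
  (κ₁ κ₂ : G →ₜ* Multiplicative ℤ_[p]) (ρ : ContinuousRep G 𝒪 A)

/-! ## §1 Two-variable invariance: `𝓜^G` = sections over `ℤ_p²/c(G)` -/

section Invariance

/-- **The two-variable action**: `(g·Φ)(x)(y) = ρ(g)(Φ(x − κ₁ g)(y − κ₂ g))` on the iterate
`C^∞(ℤ_p, C^∞(ℤ_p, A)) = C^∞(ℤ_p², A)` (`bigRep_apply_apply` twice).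
[cite: SkinnerUrban2014, §3.1.3 and Prop. 3.2.3 (the co-induced model)] -/
theorem bigRep_bigRep_apply_apply (g : G) (Φ : BigRepModule (PowerSeries 𝒪) p (BigRepModule 𝒪 p A))
    (x y : ℤ_[p]) :
    bigRep κ₁ (bigRep κ₂ ρ) g Φ x y = ρ g (Φ (x - (κ₁ g).toAdd) (y - (κ₂ g).toAdd)) := by
  rw [bigRep_apply_apply, bigRep_apply_apply]

/-- **Invariance read at a shifted point**: for `G`-invariant `Φ`, `Φ(x + κ₁ g)(y + κ₂ g) = ρ(g)(Φ x y)` —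
`𝓜^G` consists of SECTIONS `Φ(z + c g) = ρ(g) Φ(z)` over `ℤ_p²`, `c = (κ₁, κ₂)`.
[cite: JetchevSkinnerWan2017, §3.4, proof of Lemma 3.4.1 (arXiv:1512.06894 p. 14)] -/
theorem apply_add_apply_add_of_forall_eq {Φ : BigRepModule (PowerSeries 𝒪) p (BigRepModule 𝒪 p A)}
    (hΦ : ∀ g : G, bigRep κ₁ (bigRep κ₂ ρ) g Φ = Φ) (g : G) (x y : ℤ_[p]) :
    Φ (x + (κ₁ g).toAdd) (y + (κ₂ g).toAdd) = ρ g (Φ x y) := by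
  have h := congrArg (fun Ψ : BigRepModule (PowerSeries 𝒪) p (BigRepModule 𝒪 p A) ↦
    Ψ (x + (κ₁ g).toAdd) (y + (κ₂ g).toAdd)) (hΦ g)
  simp only [bigRep_bigRep_apply_apply, add_sub_cancel_right] at h
  exact h.symm

/-- **The values of an invariant are fixed by `ker c = ker κ₁ ∩ ker κ₂`** (`P_K = G_{K_{∞,v}}` of [JSW17]
Case 3(b): `Φ(z) ∈ A^{P}`). [cite: JetchevSkinnerWan2017, §3.3–3.4, Case 3(b) (arXiv:1512.06894 p. 13: 𝓜^{P_v})] -/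
theorem apply_apply_eq_of_forall_eq {Φ : BigRepModule (PowerSeries 𝒪) p (BigRepModule 𝒪 p A)}
    (hΦ : ∀ g : G, bigRep κ₁ (bigRep κ₂ ρ) g Φ = Φ) (x y : ℤ_[p]) {g : G} (h₁ : κ₁ g = 1)
    (h₂ : κ₂ g = 1) : ρ g (Φ x y) = Φ x y := by
  have h := apply_add_apply_add_of_forall_eq κ₁ κ₂ ρ hΦ g x y
  rw [h₁, h₂, toAdd_one, add_zero, add_zero] at h
  exact h.symm

/-- **Determination by the values on a covering set**: two invariants which agree at every point of a set
`R ⊆ ℤ_p²` meeting every coset `z + c(G)` are equal (a section is determined on each orbit by one value).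
[cite: JetchevSkinnerWan2017, §3.4, proof of Lemma 3.4.1 (arXiv:1512.06894 p. 14)] -/
theorem eq_of_forall_eq_of_cover {Φ Φ' : BigRepModule (PowerSeries 𝒪) p (BigRepModule 𝒪 p A)}
    (hΦ : ∀ g : G, bigRep κ₁ (bigRep κ₂ ρ) g Φ = Φ) (hΦ' : ∀ g : G, bigRep κ₁ (bigRep κ₂ ρ) g Φ' = Φ')
    {R : Set (ℤ_[p] × ℤ_[p])}
    (hcov : ∀ z : ℤ_[p] × ℤ_[p], ∃ r ∈ R, ∃ g : G, z.1 = r.1 + (κ₁ g).toAdd ∧ z.2 = r.2 + (κ₂ g).toAdd)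
    (heq : ∀ r ∈ R, Φ r.1 r.2 = Φ' r.1 r.2) : Φ = Φ' := by
  refine BigRepModule.ext fun x ↦ BigRepModule.ext fun y ↦ ?_
  obtain ⟨r, hr, g, hx, hy⟩ := hcov (x, y)
  dsimp only at hx hy
  rw [hx, hy, apply_add_apply_add_of_forall_eq κ₁ κ₂ ρ hΦ, apply_add_apply_add_of_forall_eq κ₁ κ₂ ρ hΦ',
    heq r hr]

end Invariance

/-! ## §2 Uniform smoothness of `c`-small elements on finitely many `ker c`-fixed vectors (compactness) -/

section Compact

omit [IsTopologicalGroup G] [TopologicalSpace (PowerSeries 𝒪)]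
  [TopologicalSpace (PowerSeries (PowerSeries 𝒪))] in
/-- **Uniform stabiliser level from COMPACTNESS.** For `G` compact and a finite set `S` of vectors fixed by
`ker c` (`c = (κ₁, κ₂) : G → ℤ_p²`), there is `m` such that every `g` with `c(g) ∈ p^m ℤ_p²` fixes `S`:
the common stabiliser `U` of `S` is open (`A` discrete), `G ∖ U` is compact, so `c(G ∖ U)` is closed in
`ℤ_p²`; it misses `0` (`c g = 0 ⟹ g ∈ ker c ⊆ U`), hence misses a neighbourhood `p^m ℤ_p²` of `0`.
(This is the smoothness of the sections `z ↦ ρ(g_z) b` used to realise every value pattern in `𝓜^G`.)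
[cite: SkinnerUrban2014, §3.1.1 (continuity: open stabilisers of a discrete module), Prop. 3.2.3] -/
theorem exists_level_of_forall_fixed [CompactSpace G] (S : Finset A)
    (hS : ∀ b ∈ S, ∀ g : G, κ₁ g = 1 → κ₂ g = 1 → ρ g b = b) :
    ∃ m : ℕ, ∀ g : G, (κ₁ g).toAdd ∈ Ideal.span {(p : ℤ_[p]) ^ m} →
      (κ₂ g).toAdd ∈ Ideal.span {(p : ℤ_[p]) ^ m} → ∀ b ∈ S, ρ g b = b := by
  classical
  -- the continuous map `c = (κ₁, κ₂) : G → ℤ_p × ℤ_p`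
  let c : G → ℤ_[p] × ℤ_[p] := fun g ↦ ((κ₁ g).toAdd, (κ₂ g).toAdd)
  have hc : Continuous c :=
    (continuous_toAdd.comp (map_continuous κ₁)).prodMk (continuous_toAdd.comp (map_continuous κ₂))
  have hκ : ∀ (κ : G →ₜ* Multiplicative ℤ_[p]) (g : G), (κ g).toAdd = 0 → κ g = 1 := fun κ g h ↦ by
    rw [← ofAdd_toAdd (κ g), h, ofAdd_zero]
  -- the common stabiliser `U` of `S` is open
  let U : Set G := ⋂ b ∈ S, {g : G | ρ g b = b}
  have hU : IsOpen U :=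
    isOpen_biInter_finset fun b _ ↦ (isOpen_discrete ({b} : Set A)).preimage (ρ.continuous_apply_left b)
  -- `c(G ∖ U)` is closed and misses `0`
  have hK : IsClosed (c '' Uᶜ) := (hU.isClosed_compl.isCompact.image hc).isClosed
  have h0 : (0 : ℤ_[p] × ℤ_[p]) ∈ (c '' Uᶜ)ᶜ := by
    rintro ⟨g, hgU, hg0⟩
    apply hgU
    simp only [U, Set.mem_iInter, Set.mem_setOf_eq]
    intro b hb
    have h1 : (κ₁ g).toAdd = 0 := congrArg Prod.fst hg0
    have h2 : (κ₂ g).toAdd = 0 := congrArg Prod.snd hg0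
    exact hS b hb g (hκ κ₁ g h1) (hκ κ₂ g h2)
  -- so it misses a ball around `0`, which contains some `p^m ℤ_p²`
  obtain ⟨ε, hε, hball⟩ := Metric.isOpen_iff.mp hK.isOpen_compl 0 h0
  obtain ⟨m, hm⟩ := PadicInt.exists_pow_neg_lt p hε
  refine ⟨m, fun g hg₁ hg₂ b hb ↦ ?_⟩
  have hmem : c g ∈ Metric.ball (0 : ℤ_[p] × ℤ_[p]) ε := by
    rw [mem_ball_zero_iff, Prod.norm_def]
    refine lt_of_le_of_lt (max_le ?_ ?_) hm
    · exact (PadicInt.norm_le_pow_iff_mem_span_pow _ _).mpr hg₁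
    · exact (PadicInt.norm_le_pow_iff_mem_span_pow _ _).mpr hg₂
  have hgU : g ∈ U := by
    by_contra hgU
    exact hball hmem ⟨g, hgU, rfl⟩
  simp only [U, Set.mem_iInter, Set.mem_setOf_eq] at hgU
  exact hgU b hb

end Compact

/-! ## §3 Finite representatives of `ℤ_p²/c(G)` when `c(G) ⊇ pⁿℤ_p²` -/

section Reps

omit [TopologicalSpace 𝒪] [TopologicalSpace A] [DiscreteTopology A] [IsTopologicalGroup G]
  [TopologicalSpace (PowerSeries 𝒪)] [TopologicalSpace (PowerSeries (PowerSeries 𝒪))] in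
/-- **Finite coset representatives.** If the image `c(G)` of `c = (κ₁, κ₂)` contains `pⁿℤ_p²` (the
decomposition group is OPEN in `Γ_K ≅ ℤ_p²`), there is a finite `R ⊆ ℤ_p²` meeting every coset of `c(G)`
(COVERING) in exactly one point (INDEPENDENT): the `Quotient.out`-representatives of the finite group
`ℤ_p²/c(G)` (finite: every class has a representative `(i, j)` with `i, j < pⁿ`, `PadicInt.appr`).
[cite: JetchevSkinnerWan2017, §3.3, Case 3(b) (arXiv:1512.06894 p. 13: the finite decomposition at v)] -/
theorem exists_finset_cover_indep
    (hOpen : ∃ n : ℕ, ∀ x y : ℤ_[p], ∃ g : G, (κ₁ g).toAdd = p ^ n * x ∧ (κ₂ g).toAdd = p ^ n * y) :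
    ∃ R : Finset (ℤ_[p] × ℤ_[p]),
      (∀ z : ℤ_[p] × ℤ_[p], ∃ r ∈ R, ∃ g : G, z.1 = r.1 + (κ₁ g).toAdd ∧ z.2 = r.2 + (κ₂ g).toAdd) ∧
      (∀ r ∈ R, ∀ r' ∈ R, ∀ g : G,
        r'.1 = r.1 + (κ₁ g).toAdd → r'.2 = r.2 + (κ₂ g).toAdd → r' = r) := by
  classical
  obtain ⟨n, hn⟩ := hOpen
  -- the image subgroup `D = c(G)`
  let D : AddSubgroup (ℤ_[p] × ℤ_[p]) :=
    { carrier := {w | ∃ g : G, (κ₁ g).toAdd = w.1 ∧ (κ₂ g).toAdd = w.2}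
      zero_mem' := ⟨1, by rw [map_one, toAdd_one, Prod.fst_zero], by rw [map_one, toAdd_one, Prod.snd_zero]⟩
      add_mem' := by
        rintro w w' ⟨g, hg₁, hg₂⟩ ⟨g', hg₁', hg₂'⟩
        exact ⟨g * g', by rw [map_mul, toAdd_mul, hg₁, hg₁', Prod.fst_add],
          by rw [map_mul, toAdd_mul, hg₂, hg₂', Prod.snd_add]⟩
      neg_mem' := by
        rintro w ⟨g, hg₁, hg₂⟩
        exact ⟨g⁻¹, by rw [map_inv, toAdd_inv, hg₁, Prod.fst_neg],
          by rw [map_inv, toAdd_inv, hg₂, Prod.snd_neg]⟩ }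
  have hD : ∀ w : ℤ_[p] × ℤ_[p], w ∈ D ↔ ∃ g : G, (κ₁ g).toAdd = w.1 ∧ (κ₂ g).toAdd = w.2 :=
    fun w ↦ Iff.rfl
  -- `pⁿℤ_p² ⊆ D`
  have hpn : ∀ w : ℤ_[p] × ℤ_[p], w.1 ∈ Ideal.span {(p : ℤ_[p]) ^ n} →
      w.2 ∈ Ideal.span {(p : ℤ_[p]) ^ n} → w ∈ D := by
    intro w hw₁ hw₂
    obtain ⟨x, hx⟩ := Ideal.mem_span_singleton'.mp hw₁
    obtain ⟨y, hy⟩ := Ideal.mem_span_singleton'.mp hw₂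
    obtain ⟨g, hg₁, hg₂⟩ := hn x y
    exact ⟨g, by rw [hg₁, ← hx, mul_comm], by rw [hg₂, ← hy, mul_comm]⟩
  -- the quotient `ℤ_p²/D` is finite: every class is represented by `(i, j)`, `i, j < pⁿ`
  have hfin : Finite ((ℤ_[p] × ℤ_[p]) ⧸ D) := by
    refine Finite.of_surjective
      (fun ij : Fin (p ^ n) × Fin (p ^ n) ↦
        (QuotientAddGroup.mk (((ij.1 : ℕ) : ℤ_[p]), ((ij.2 : ℕ) : ℤ_[p])) : (ℤ_[p] × ℤ_[p]) ⧸ D)) ?_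
    intro q
    induction q using QuotientAddGroup.induction_on with
    | H z =>
      refine ⟨(⟨z.1.appr n, PadicInt.appr_lt _ _⟩, ⟨z.2.appr n, PadicInt.appr_lt _ _⟩), ?_⟩
      dsimp only
      rw [QuotientAddGroup.eq]
      refine hpn _ ?_ ?_
      · rw [Prod.fst_add, Prod.fst_neg, neg_add_eq_sub]
        exact PadicInt.appr_spec n z.1
      · rw [Prod.snd_add, Prod.snd_neg, neg_add_eq_sub]
        exact PadicInt.appr_spec n z.2
  haveI : Fintype ((ℤ_[p] × ℤ_[p]) ⧸ D) := Fintype.ofFinite _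
  refine ⟨Finset.univ.image (fun q : (ℤ_[p] × ℤ_[p]) ⧸ D ↦ q.out), fun z ↦ ?_, ?_⟩
  · -- covering: `z` and the representative of its class differ by an element of `D`
    refine ⟨(QuotientAddGroup.mk z : (ℤ_[p] × ℤ_[p]) ⧸ D).out,
      Finset.mem_image_of_mem _ (Finset.mem_univ _), ?_⟩
    have h : (QuotientAddGroup.mk ((QuotientAddGroup.mk z : (ℤ_[p] × ℤ_[p]) ⧸ D).out) :
        (ℤ_[p] × ℤ_[p]) ⧸ D) = QuotientAddGroup.mk z := QuotientAddGroup.out_eq' _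
    rw [QuotientAddGroup.eq, hD] at h
    obtain ⟨g, hg₁, hg₂⟩ := h
    refine ⟨g, ?_, ?_⟩
    · rw [hg₁, Prod.fst_add, Prod.fst_neg, add_neg_cancel_left]
    · rw [hg₂, Prod.snd_add, Prod.snd_neg, add_neg_cancel_left]
  · -- independence: two representatives differing by an element of `D` represent the same class
    intro r hr r' hr' g h₁ h₂
    obtain ⟨q, -, rfl⟩ := Finset.mem_image.mp hr
    obtain ⟨q', -, rfl⟩ := Finset.mem_image.mp hr'
    have h : (QuotientAddGroup.mk q.out : (ℤ_[p] × ℤ_[p]) ⧸ D) = QuotientAddGroup.mk q'.out := by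
      rw [QuotientAddGroup.eq, hD]
      exact ⟨g, by rw [Prod.fst_add, Prod.fst_neg, h₁, neg_add_cancel_left],
        by rw [Prod.snd_add, Prod.snd_neg, h₂, neg_add_cancel_left]⟩
    rw [QuotientAddGroup.out_eq', QuotientAddGroup.out_eq'] at h
    rw [h]

end Reps

/-! ## §4 On invariants, `(1+T_c)^N − 1` is the value endomorphism `ρ(g₁) − 1` -/

section Shift

/-- **`((((1+T_c)^N − 1)) • Φ) x y = ρ(g₁)(Φ x y) − Φ x y`** for `G`-invariant `Φ` and `g₁ ∈ ker κ₂` with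
`κ₁ g₁ = N`: the outer variable `(1+T_c)^N` translates `x` by `N = κ₁ g₁`, which on invariants is the action
of `g₁` on the values (`InvariantsShift.one_add_X_pow_sub_one_smul_apply_of_forall_bigRep_eq` for the outer
`bigRep`), and `g₁ ∈ ker κ₂` acts on the inner big module through `ρ` on the values
(`InvariantsShift.bigRep_apply_apply_of_kappa_eq_one`). [JSW17]'s `γ₊` realised by a group element.
[cite: JetchevSkinnerWan2017, §3.4, Lemma 3.4.1, proof (arXiv:1512.06894 p. 14)] -/
theorem one_add_X_pow_sub_one_smul_apply_apply
    {Φ : BigRepModule (PowerSeries 𝒪) p (BigRepModule 𝒪 p A)}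
    (hΦ : ∀ g : G, bigRep κ₁ (bigRep κ₂ ρ) g Φ = Φ) {g₁ : G} {N : ℕ}
    (hg₁ : (κ₁ g₁).toAdd = (N : ℤ_[p])) (hg₂ : κ₂ g₁ = 1) (x y : ℤ_[p]) :
    ((((1 : PowerSeries (PowerSeries 𝒪)) + X) ^ N - 1) • Φ) x y = ρ g₁ (Φ x y) - Φ x y := by
  rw [InvariantsShift.one_add_X_pow_sub_one_smul_apply_of_forall_bigRep_eq κ₁ (bigRep κ₂ ρ) hΦ hg₁ x,
    BigRepModule.sub_apply, InvariantsShift.bigRep_apply_apply_of_kappa_eq_one κ₂ ρ hg₂]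

end Shift

end Summit.BirchSwinnertonDyer.BirchSwinnertonDyer.Theorems.ErratumThm23TwoVariable.Sections

end
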